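import Mathlib.Analysis.Calculus.MeanValue
import Literature.Analysis.FluidPDE.FiniteFourierModeEulerVec

/-!
# Kishimoto–Yoneda: the Fourier-side Euler system as pair interactions; simply interacting pairs

Support file for `FiniteFourierModeEuler` (N. Kishimoto, T. Yoneda, J. Math. Fluid Mech. 24
(2022) 74 = arXiv:2110.08039). For a finite-mode Euler solution
`hS : KY.IsFiniteModeEulerSolution I S u` (Def. 1.1 + (1.3)) we PROVE the bookkeeping facts the
paper uses tacitly throughout §§3–4:

* the nonlinearity (1.3) is `(i/2) P̂_n Σ_{(n₁,n₂) ∈ S², n₁+n₂=n} bracket` (`nonlin_eq_sum_bracket`),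
  diagonal pairs `(a, a)` contribute nothing (`bracket_self_eq_zero`, "the zero mode does not
  appear due to the divergence-free condition");
* at an UNOCCUPIED frequency `m ∉ S`, `m ≠ 0`, the projected pair interactions sum to zero
  (`sum_proj_bracket_eq_zero`);
* **Remark 4.3 (i)**: a SIMPLY INTERACTING PAIR (Def. 4.2 (i): `n₁ + n₂ ∉ S` and
  `n₁ + n₂ = n₃ + n₄` with `n₃ ≠ n₄ ∈ S` only for `{n₃, n₄} = {n₁, n₂}`) does not interact, i.e.
  satisfies (2.3) at every time (`nonInteracting_of_sip`);
* two elementary sources of simply interacting pairs used in §3 and §4 (proof of Lemma 4.5 (i),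
  of Prop. 3.1 (i) and of Prop. 4.8): a pair EXPOSED by a linear functional `x ↦ a·x`
  (`sip_of_exposed`: "`f ≡ 1` on `E`, `f ≤ 1` on `S`" ⇒ SIP), and the unique maximiser of a
  functional together with any maximiser of the functional on the remaining points
  (`sip_of_top_two`);
* stationarity mechanics: if at time `t` every pair of distinct occupied modes whose sum is
  occupied does not interact, then `∂_t u_n(t) = 0` for all `n` (`deriv_eq_zero_of_nonInteracting`,
  the last paragraph of §4), and a mode with vanishing time derivative on the open interval `I` is
  constant on `I` (`eq_of_deriv_eq_zero`).

## References

* [KishimotoYoneda2022] N. Kishimoto, T. Yoneda, J. Math. Fluid Mech. 24 (2022) 74 =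
  arXiv:2110.08039, §1 (1.3), §4 Def. 4.2 (i), Remark 4.3 (i), proofs of Lemma 4.5 and Prop. 4.8.
-/

noncomputable section

open Matrix Finset

namespace Literature.Analysis.FluidPDE

namespace KY

/-! ### The nonlinearity as a sum of pair brackets -/

/-- Diagonal pairs do not contribute: `bracket a a v v = 2(v·a) v = 0` for divergence-free `v`
("the zero mode does not appear due to the divergence-free condition").
[cite: KishimotoYoneda2022, §1 (before (1.3))] -/
theorem bracket_self_eq_zero {a : Fin 3 → ℝ} {v : Fin 3 → ℂ} (h : dot (cplx a) v = 0) :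
    bracket a a v v = 0 := by
  rw [dot_comm] at h
  simp [bracket, h]

/-- A bracket with a vanishing first vector vanishes. [cite: KishimotoYoneda2022, §2 Lemma 2.1] -/
@[simp] theorem bracket_zero_left (n₁ n₂ : Fin 3 → ℝ) (u₂ : Fin 3 → ℂ) : bracket n₁ n₂ 0 u₂ = 0 := by
  simp [bracket]

/-- A bracket with a vanishing second vector vanishes. [cite: KishimotoYoneda2022, §2 Lemma 2.1] -/
@[simp] theorem bracket_zero_right (n₁ n₂ : Fin 3 → ℝ) (u₁ : Fin 3 → ℂ) : bracket n₁ n₂ u₁ 0 = 0 := by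
  simp [bracket]

open scoped Classical in
/-- The Fourier-side Euler nonlinearity (1.3) as a sum of pair brackets over the ordered pairs of
occupied frequencies summing to `n`. [cite: KishimotoYoneda2022, §1 (1.3)] -/
theorem nonlin_eq_sum_bracket (S : Finset (Fin 3 → ℝ)) (c : (Fin 3 → ℝ) → (Fin 3 → ℂ))
    (n : Fin 3 → ℝ) :
    nonlin S c n = (Complex.I / 2) •
      proj n (∑ q ∈ (S ×ˢ S).filter (fun q => q.1 + q.2 = n), bracket q.1 q.2 (c q.1) (c q.2)) := by
  rw [nonlin, Finset.sum_filter]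
  rfl

open scoped Classical in
/-- [cite: KishimotoYoneda2022, §1 (1.3)] -/
theorem nonlin_apply_eq (S : Finset (Fin 3 → ℝ)) (c : (Fin 3 → ℝ) → (Fin 3 → ℂ))
    (n : Fin 3 → ℝ) :
    nonlin S c n = (Complex.I / 2) •
      ∑ q ∈ (S ×ˢ S).filter (fun q => q.1 + q.2 = n), proj n (bracket q.1 q.2 (c q.1) (c q.2)) := by
  rw [nonlin_eq_sum_bracket, proj_sum]

end KY

namespace KY.IsFiniteModeEulerSolution

open KY

variable {I : Set ℝ} {S : Finset (Fin 3 → ℝ)} {u : (Fin 3 → ℝ) → ℝ → (Fin 3 → ℂ)}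

/-- Occupied frequencies are non-zero. [cite: KishimotoYoneda2022, §1 Def. 1.1] -/
theorem ne_zero_of_mem (hS : IsFiniteModeEulerSolution I S u) {n : Fin 3 → ℝ} (hn : n ∈ S) :
    n ≠ 0 := by
  rintro rfl; exact hS.zero_notMem hn

/-- [cite: KishimotoYoneda2022, §1 Def. 1.1] -/
theorem neg_mem_iff (hS : IsFiniteModeEulerSolution I S u) {n : Fin 3 → ℝ} : -n ∈ S ↔ n ∈ S :=
  ⟨fun h => by simpa using hS.neg_mem _ h, hS.neg_mem n⟩

/-- At an occupied frequency the Euler system (1.3) reads `∂_t u_n = -(nonlinearity)_n`.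
[cite: KishimotoYoneda2022, §1 (1.3)] -/
theorem deriv_eq (hS : IsFiniteModeEulerSolution I S u) {n : Fin 3 → ℝ} (hn : n ≠ 0) {t : ℝ}
    (ht : t ∈ I) (i : Fin 3) :
    deriv (fun s => u n s i) t = -(nonlin S (fun m => u m t) n i) :=
  eq_neg_of_add_eq_zero_left (hS.euler n hn t ht i)

/-- The time derivative of an unoccupied mode vanishes. [cite: KishimotoYoneda2022, §1 Def. 1.1] -/
theorem deriv_eq_zero_of_notMem (hS : IsFiniteModeEulerSolution I S u) {n : Fin 3 → ℝ}
    (hn : n ∉ S) (t : ℝ) (i : Fin 3) : deriv (fun s => u n s i) t = 0 := by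
  have : (fun s => u n s i) = fun _ => 0 := by
    funext s; rw [hS.eq_zero_of_notMem n hn s]; rfl
  rw [this, deriv_const]

/-- At an unoccupied non-zero frequency the nonlinearity vanishes ("the vanishing of the
projected interaction at unoccupied modes"). [cite: KishimotoYoneda2022, §1 (1.3)] -/
theorem nonlin_eq_zero_of_notMem (hS : IsFiniteModeEulerSolution I S u) {m : Fin 3 → ℝ}
    (hm : m ∉ S) (hm0 : m ≠ 0) {t : ℝ} (ht : t ∈ I) : nonlin S (fun k => u k t) m = 0 := by
  ext i
  have h := hS.euler m hm0 t ht i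
  rwa [hS.deriv_eq_zero_of_notMem hm, zero_add] at h

open scoped Classical in
/-- **Pair interactions cancel at unoccupied frequencies**: for `m ∉ S`, `m ≠ 0`,
`Σ_{(n₁,n₂) ∈ S², n₁+n₂=m} P̂_m[(u_{n₁}·n₂)u_{n₂} + (u_{n₂}·n₁)u_{n₁}] = 0` at every time.
[cite: KishimotoYoneda2022, §1 (1.3) and §4 Remark 4.3 (i)] -/
theorem sum_proj_bracket_eq_zero (hS : IsFiniteModeEulerSolution I S u) {m : Fin 3 → ℝ}
    (hm : m ∉ S) (hm0 : m ≠ 0) {t : ℝ} (ht : t ∈ I) :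
    ∑ q ∈ (S ×ˢ S).filter (fun q => q.1 + q.2 = m),
      proj m (bracket q.1 q.2 (u q.1 t) (u q.2 t)) = 0 := by
  have h := hS.nonlin_eq_zero_of_notMem hm hm0 ht
  rw [nonlin_apply_eq, smul_eq_zero] at h
  exact h.resolve_left (div_ne_zero Complex.I_ne_zero two_ne_zero)

/-- Diagonal pairs of an occupied mode do not contribute. [cite: KishimotoYoneda2022, §1 (before (1.3))] -/
theorem bracket_self (hS : IsFiniteModeEulerSolution I S u) {a : Fin 3 → ℝ} (ha : a ∈ S) {t : ℝ}
    (ht : t ∈ I) : bracket a a (u a t) (u a t) = 0 :=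
  bracket_self_eq_zero (hS.div_free a ha t ht)

/-- Real-valuedness: the pair `(-a, -b)` interacts iff `(a, b)` does. [cite: KishimotoYoneda2022, §1 Def. 1.1] -/
theorem nonInteracting_neg_iff (hS : IsFiniteModeEulerSolution I S u) (a b : Fin 3 → ℝ) (t : ℝ) :
    NonInteracting (-a) (-b) (u (-a) t) (u (-b) t) ↔ NonInteracting a b (u a t) (u b t) := by
  rw [hS.conj a t, hS.conj b t, nonInteracting_neg_star_iff]

/-! ### Simply interacting pairs do not interact (Remark 4.3 (i)) -/

open scoped Classical in
/-- **Remark 4.3 (i).** A simply interacting pair (Def. 4.2 (i)) of occupied frequencies —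
`n₁ ≠ n₂ ∈ S`, `n₁ + n₂ ∉ S`, and `n₃ + n₄ = n₁ + n₂` with `n₃ ≠ n₄ ∈ S` only for
`{n₃, n₄} = {n₁, n₂}` — satisfies the non-interaction condition (2.3) at every time of `I`.
[cite: KishimotoYoneda2022, §4 Def. 4.2 (i) and Remark 4.3 (i)] -/
theorem nonInteracting_of_sip (hS : IsFiniteModeEulerSolution I S u) {n₁ n₂ : Fin 3 → ℝ}
    (h₁ : n₁ ∈ S) (h₂ : n₂ ∈ S) (hne : n₁ ≠ n₂) (hsum : n₁ + n₂ ∉ S)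
    (huniq : ∀ n₃ ∈ S, ∀ n₄ ∈ S, n₃ ≠ n₄ → n₃ + n₄ = n₁ + n₂ →
      (n₃ = n₁ ∧ n₄ = n₂) ∨ (n₃ = n₂ ∧ n₄ = n₁))
    {t : ℝ} (ht : t ∈ I) : NonInteracting n₁ n₂ (u n₁ t) (u n₂ t) := by
  by_cases hm0 : n₁ + n₂ = 0
  · have hk : n₁ ⨯₃ n₂ = 0 := by
      have : n₂ = -n₁ := by rw [← sub_eq_zero, sub_neg_eq_add, add_comm, hm0]
      rw [this, LinearMap.map_neg, cross_self, neg_zero]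
    exact nonInteracting_of_cross_eq_zero (hS.ne_zero_of_mem h₁) (hS.ne_zero_of_mem h₂) hk
      (hS.div_free n₁ h₁ t ht) (hS.div_free n₂ h₂ t ht)
  have hsum0 := hS.sum_proj_bracket_eq_zero hsum hm0 ht
  set T := (S ×ˢ S).filter (fun q => q.1 + q.2 = n₁ + n₂) with hT
  have hmem₁ : (n₁, n₂) ∈ T := by simp [hT, h₁, h₂]
  have hmem₂ : (n₂, n₁) ∈ T := by simp [hT, h₁, h₂, add_comm]
  have hne' : (n₁, n₂) ≠ (n₂, n₁) := by
    intro h; exact hne (Prod.ext_iff.1 h).1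
  rw [Finset.sum_eq_add_of_mem _ _ hmem₁ hmem₂ hne'] at hsum0
  · rw [bracket_comm n₁ n₂] at hsum0
    have : (2 : ℂ) • proj (n₁ + n₂) (bracket n₁ n₂ (u n₁ t) (u n₂ t)) = 0 := by
      rw [two_smul]; exact hsum0
    exact (smul_eq_zero.1 this).resolve_left two_ne_zero
  · rintro ⟨a, b⟩ hq ⟨hqa, hqb⟩
    simp only [hT, Finset.mem_filter, Finset.mem_product] at hq
    obtain ⟨⟨ha, hb⟩, hab⟩ := hq
    by_cases hdiag : a = b
    · subst hdiag
      rw [hS.bracket_self ha ht, proj_zero]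
    · rcases huniq a ha b hb hdiag hab with ⟨rfl, rfl⟩ | ⟨rfl, rfl⟩
      · exact absurd rfl hqa
      · exact absurd rfl hqb

/-! ### Two sources of simply interacting pairs -/

omit u I in
/-- **An exposed pair is simply interacting** (the argument of Lemma 4.5 (i) / Prop. 3.1 (i) (a)
with the functional `f`): if the linear functional `x ↦ a·x` takes the same value at
`n₁ ≠ n₂ ∈ S` and a strictly smaller value at every other point of the symmetric set `S ∌ 0`, and
`n₁ + n₂ ≠ 0`, then `n₁ + n₂ ∉ S` and `n₁ + n₂ = n₃ + n₄` (`n₃ ≠ n₄ ∈ S`) forces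
`{n₃, n₄} = {n₁, n₂}`. [cite: KishimotoYoneda2022, §4 proof of Lemma 4.5 (i)] -/
theorem _root_.Literature.Analysis.FluidPDE.KY.sip_of_exposed {S : Finset (Fin 3 → ℝ)}
    (h0 : (0 : Fin 3 → ℝ) ∉ S) (hsymm : ∀ n ∈ S, -n ∈ S) {a n₁ n₂ : Fin 3 → ℝ}
    (h₁ : n₁ ∈ S) (hne : n₁ ≠ n₂) (hm0 : n₁ + n₂ ≠ 0) (hlev : a ⬝ᵥ n₂ = a ⬝ᵥ n₁)
    (hexp : ∀ n ∈ S, n ≠ n₁ → n ≠ n₂ → a ⬝ᵥ n < a ⬝ᵥ n₁) :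
    n₁ + n₂ ∉ S ∧ ∀ n₃ ∈ S, ∀ n₄ ∈ S, n₃ ≠ n₄ → n₃ + n₄ = n₁ + n₂ →
      (n₃ = n₁ ∧ n₄ = n₂) ∨ (n₃ = n₂ ∧ n₄ = n₁) := by
  have hn₁ : n₁ ≠ 0 := by rintro rfl; exact h0 h₁
  -- the common level is positive: compare with `-n₁ ∈ S`
  have hpos : 0 < a ⬝ᵥ n₁ := by
    have hneg : -n₁ ∈ S := hsymm n₁ h₁
    have h1 : -n₁ ≠ n₁ := fun h => hn₁ (by
      have : (2 : ℝ) • n₁ = 0 := by rw [two_smul]; nth_rewrite 1 [← h]; simp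
      exact (smul_eq_zero.1 this).resolve_left two_ne_zero)
    have h2 : -n₁ ≠ n₂ := fun h => hm0 (by rw [← h, add_neg_cancel])
    have := hexp (-n₁) hneg h1 h2
    rw [dotProduct_neg] at this
    linarith
  have hle : ∀ n ∈ S, a ⬝ᵥ n ≤ a ⬝ᵥ n₁ := by
    intro n hn
    by_cases e₁ : n = n₁
    · rw [e₁]
    by_cases e₂ : n = n₂
    · rw [e₂, hlev]
    · exact (hexp n hn e₁ e₂).le
  refine ⟨fun hm => ?_, fun n₃ h₃ n₄ h₄ h34 hsum => ?_⟩
  · have := hle _ hm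
    rw [dotProduct_add, hlev] at this
    linarith
  · have hs : a ⬝ᵥ n₃ + a ⬝ᵥ n₄ = 2 * a ⬝ᵥ n₁ := by
      rw [← dotProduct_add, hsum, dotProduct_add, hlev]; ring
    have e₃ : a ⬝ᵥ n₃ = a ⬝ᵥ n₁ := le_antisymm (hle _ h₃) (by linarith [hle _ h₄])
    have e₄ : a ⬝ᵥ n₄ = a ⬝ᵥ n₁ := by linarith
    have mem₃ : n₃ = n₁ ∨ n₃ = n₂ := by
      by_contra hc; push Not at hc
      exact (hexp n₃ h₃ hc.1 hc.2).ne e₃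
    have mem₄ : n₄ = n₁ ∨ n₄ = n₂ := by
      by_contra hc; push Not at hc
      exact (hexp n₄ h₄ hc.1 hc.2).ne e₄
    rcases mem₃ with rfl | rfl <;> rcases mem₄ with rfl | rfl
    · exact absurd rfl h34
    · exact Or.inl ⟨rfl, rfl⟩
    · exact Or.inr ⟨rfl, rfl⟩
    · exact absurd rfl h34

omit u I in
/-- **The unique maximiser of a functional and a second-level point are simply interacting**
(the mechanism of Step 1 / Prop. 4.8: "the mode created by such two points could not be in `S`
and could not be achieved by any other pairs"): if `x ↦ a·x` has the unique maximiser `n₁` on the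
symmetric set `S ∌ 0` and `n₂ ∈ S ∖ {n₁}` maximises it on `S ∖ {n₁}`, then `(n₁, n₂)` is simply
interacting. [cite: KishimotoYoneda2022, §1 Step 1 and §4 proof of Prop. 4.8] -/
theorem _root_.Literature.Analysis.FluidPDE.KY.sip_of_top_two {S : Finset (Fin 3 → ℝ)}
    (h0 : (0 : Fin 3 → ℝ) ∉ S) (hsymm : ∀ n ∈ S, -n ∈ S) {a n₁ n₂ : Fin 3 → ℝ}
    (h₁ : n₁ ∈ S) (h₂ : n₂ ∈ S) (hne : n₂ ≠ n₁)
    (htop : ∀ n ∈ S, n ≠ n₁ → a ⬝ᵥ n < a ⬝ᵥ n₁) (hsec : ∀ n ∈ S, n ≠ n₁ → a ⬝ᵥ n ≤ a ⬝ᵥ n₂) :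
    n₁ + n₂ ∉ S ∧ ∀ n₃ ∈ S, ∀ n₄ ∈ S, n₃ ≠ n₄ → n₃ + n₄ = n₁ + n₂ →
      (n₃ = n₁ ∧ n₄ = n₂) ∨ (n₃ = n₂ ∧ n₄ = n₁) := by
  have hn₁ : n₁ ≠ 0 := by rintro rfl; exact h0 h₁
  have hn₂ : n₂ ≠ 0 := by rintro rfl; exact h0 h₂
  have hpos : 0 < a ⬝ᵥ n₁ := by
    have hneg : -n₁ ∈ S := hsymm n₁ h₁
    have h1 : -n₁ ≠ n₁ := fun h => hn₁ (by
      have : (2 : ℝ) • n₁ = 0 := by rw [two_smul]; nth_rewrite 1 [← h]; simp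
      exact (smul_eq_zero.1 this).resolve_left two_ne_zero)
    have := htop (-n₁) hneg h1
    rw [dotProduct_neg] at this
    linarith
  have h21 : a ⬝ᵥ n₂ < a ⬝ᵥ n₁ := htop n₂ h₂ hne
  refine ⟨fun hm => ?_, fun n₃ h₃ n₄ h₄ h34 hsum => ?_⟩
  · have hm1 : n₁ + n₂ ≠ n₁ := fun h => hn₂ (by simpa using h)
    have := hsec _ hm hm1
    rw [dotProduct_add] at this
    linarith
  · have hs : a ⬝ᵥ n₃ + a ⬝ᵥ n₄ = a ⬝ᵥ n₁ + a ⬝ᵥ n₂ := by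
      rw [← dotProduct_add, hsum, dotProduct_add]
    by_cases e₃ : n₃ = n₁
    · subst e₃
      left; refine ⟨rfl, ?_⟩
      exact add_left_cancel hsum
    by_cases e₄ : n₄ = n₁
    · subst e₄
      right; refine ⟨?_, rfl⟩
      rw [add_comm] at hsum
      exact add_left_cancel hsum
    · have := htop n₃ h₃ e₃
      have := hsec n₄ h₄ e₄
      have := hsec n₃ h₃ e₃
      have := htop n₄ h₄ e₄
      exfalso; linarith

/-! ### Stationarity mechanics -/

open scoped Classical in
/-- **No interaction ⇒ no time dependence** (last paragraph of §4: "any two modes of `u(t)` do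
not interact … by (1.3) we have `∂_t u_n(t) = 0`"): if at time `t ∈ I` every pair of distinct
occupied frequencies whose sum is occupied satisfies (2.3), then all `∂_t u_n(t)` vanish.
[cite: KishimotoYoneda2022, §4 (end of the proof of Thm. 4.1)] -/
theorem deriv_eq_zero_of_nonInteracting (hS : IsFiniteModeEulerSolution I S u) {t : ℝ} (ht : t ∈ I)
    (hNI : ∀ a ∈ S, ∀ b ∈ S, a ≠ b → a + b ∈ S → NonInteracting a b (u a t) (u b t))
    (n : Fin 3 → ℝ) (i : Fin 3) : deriv (fun s => u n s i) t = 0 := by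
  by_cases hn : n ∈ S
  · rw [hS.deriv_eq (hS.ne_zero_of_mem hn) ht, nonlin_apply_eq, neg_eq_zero]
    rw [Finset.sum_eq_zero, smul_zero]
    · rfl
    rintro ⟨a, b⟩ hq
    simp only [Finset.mem_filter, Finset.mem_product] at hq
    obtain ⟨⟨ha, hb⟩, hab⟩ := hq
    by_cases hdiag : a = b
    · subst hdiag; rw [hS.bracket_self ha ht, proj_zero]
    · have := hNI a ha b hb hdiag (hab ▸ hn)
      rwa [NonInteracting, hab] at this
  · exact hS.deriv_eq_zero_of_notMem hn t i

/-- A mode whose time derivative vanishes on the open interval `I` is constant on `I`.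
[cite: KishimotoYoneda2022, §4 (end of the proof of Thm. 4.1)] -/
theorem eq_of_deriv_eq_zero (hS : IsFiniteModeEulerSolution I S u) (n : Fin 3 → ℝ)
    (h : ∀ t ∈ I, ∀ i : Fin 3, deriv (fun s => u n s i) t = 0) {t s : ℝ} (ht : t ∈ I) (hs : s ∈ I) :
    u n t = u n s := by
  ext i
  exact hS.isOpen.is_const_of_deriv_eq_zero hS.ordConnected.isPreconnected (hS.differentiableOn n i)
    (fun x hx => h x hx i) ht hs

/-- **Stationarity from non-interaction on the whole interval.** If at every time of `I` every
pair of distinct occupied frequencies with occupied sum does not interact, the solution is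
independent of time. [cite: KishimotoYoneda2022, §4 (end of the proof of Thm. 4.1)] -/
theorem stationary_of_nonInteracting (hS : IsFiniteModeEulerSolution I S u)
    (hNI : ∀ t ∈ I, ∀ a ∈ S, ∀ b ∈ S, a ≠ b → a + b ∈ S → NonInteracting a b (u a t) (u b t))
    (n : Fin 3 → ℝ) {t s : ℝ} (ht : t ∈ I) (hs : s ∈ I) : u n t = u n s :=
  hS.eq_of_deriv_eq_zero n (fun x hx i => hS.deriv_eq_zero_of_nonInteracting hx (hNI x hx) n i) ht hs

end KY.IsFiniteModeEulerSolution

end Literature.Analysis.FluidPDE
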